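import Summits.ResolutionOfSingularities.ResolutionOfSingularities.Theorems.KaplanskyLadder
import Literature.AlgebraicGeometry.Resolution.ValuationDefect
import HarnessLib

/-!
# KaplanskyLadderDefectless — decomp-res node «PerronLadder» (lens-1 g17 KaplanskyLadder → g18 PerronLadder),
tree file 3/11 of the node

Content VERBATIM from the decomp-res lens-1 g18 file `HOME/decomp-res-lens-1/g18/PerronLadder.lean` (sha256
8bb02ceefe11b749, 3725 l; it SUPERSEDES
g17 `KaplanskyLadder.lean` fb35e2e5 ⊇ g16 `ToricLadder.lean` 67376591 as landing source; PARTS I–III = the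
landed `Theorems/ToricLadderCells`,
`ToricLadderKernels`, `ToricLadderLinks`, `ToricLadderDense`, `ToricLadder` — not repeated).  HOME =
run/shared/lean/pub/decomp-res.  Critic:
CRITIC-LEDGER rows 131 (g17, 2026-08-30T18:47:14Z) and 138 (g18 CLEARED, landing order 2026-08-30T20:05:14Z); the
lens's WRITER.md (endorsed).
Landed by decomp-res writer g7 as SUPPORT of the Valuative route item 0641 `LuAlphaPTorsor` (helper files; no
Valuative route edit is made by the
decomp-res cell: the support ports Σ₁ `MonoidalStep` / Π₁ `KK05NCVAscent`, the retirement of g16's all-rank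
`ToricAscent 3` in favour of the theorem
`toricAscentRk1_three`, and the UNCHANGED located residual `NonKHToricArchLU 3 3 4` / port-free `NonKHArchLU 3 4`
stay documented tree definitions
for the Valuative tenure / operator to book).

PART IV (g17) §16 the defectless bridge: bounded tops over DEFECTLESS bases are Kaplansky–Hensel tops
(`TratOfDefectlessBase` port,
`khTop_of_defectless`, …).

[WRITER NOTE (decomp-res writer g7): namespaces `…Theses.PerronLadder` ↦ `…Theorems.KaplanskyLadder` (PART IV
= g17 §14–§16, files
`KaplanskyLadder`, `KaplanskyLadderDefectless`) and ↦ `…Theorems.PerronLadder` (PART V, files `PerronMerge`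
§17, `PerronCharts` §18–§19,
`PerronMonomialization` §20, `PerronInitialChartPrelim` + `PerronInitialChart` §21 (400-line limit),
`PerronRepresentations` §22, `PerronAscent`
§23, `PerronLadder` §24; PART IV likewise `KaplanskyHensel` §14 / `KaplanskyLadder` §15), with `open
…Theorems.ToricLadder` (+ `…KaplanskyLadder`) so the lens's unqualified references stay verbatim; `section PartV` and its
section-scoped `open`s re-opened per file; the g16 helper `intermediateField_top_fg` is the landed
`PfaffLine.intermediateField_top_fg_of_isFractionRing`
(renamed at its use, as in the landed `ToricLadder`); global `set_option` lines dropped; nothing else changed.]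

(Sources: CossartPiltant2019; CossartJannsenSaito2020; KnafKuhlmann2005 arXiv:math/0304159 §4 Thm 4.1, Lemmas
4.2–4.4; KnafKuhlmann2009 arXiv:math/0702856 Prop 3.11, Thm 1.5; Kaplansky1942 Lemma 5, Thm 3; Kuhlmann2010 Thm
2.14; Zariski1940 §B; Cutkosky arXiv:1404.7459 §2.1; ZariskiSamuelII.)
-/

noncomputable section

open IsLocalRing Literature.AlgebraicGeometry.Resolution
open Summit.ResolutionOfSingularities.ResolutionOfSingularities.Theses
open Summit.ResolutionOfSingularities.ResolutionOfSingularities.Theorems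
open Summit.ResolutionOfSingularities.ResolutionOfSingularities.Theorems.PfaffLine
open Summit.ResolutionOfSingularities.ResolutionOfSingularities.Theorems.ToricLadder

namespace Summit.ResolutionOfSingularities.ResolutionOfSingularities.Theorems.KaplanskyLadder

/-! ## 16. The defectless bridge: bounded tops over DEFECTLESS bases are Kaplansky–Hensel tops
(printed; the bridge is UNDECIDED in the tree, everything else is kernel) -/

section Defectless

variable {k K : Type} [Field k] [Field K] [Algebra k K]

/-- PRINTED BRIDGE (tag UNDECIDED · ATTACKABLE-MOD-PRINT; the port is Kaplansky's theory of
pseudo-convergent sequences, absent from Mathlib — M/L-sized).  Over a DEFECTLESS base `F` (tree predicate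
`IsDefectlessField`, Kuhlmann 2010 §1.1) inside a rank-one valued field `(K, O)`, an immediate
transcendental element `z` at BOUNDED DISTANCE from `F` (some non-zero `b` with `v b ≤ v (z - a)` for all
`a ∈ F`, multiplicative notation: `z` does not lie in the completion of `F`) is of TRANSCENDENTAL TYPE,
i.e. satisfies Kaplansky's condition (3) / Knaf–Kuhlmann's (trat).  Proof in print: `F` defectless ⇒ its
henselization `F^h` is defectless (Kuhlmann 2010 Thm. 2.14 — tree `Kuhlmann2010DefectlessIffHenselization_holds`,
PROVED), hence algebraically maximal; `F` is dense in `F^h` (rank one; Kuhlmann 2010 Lemma 2.4 — tree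
`HenselizationDensity`, PROVED); a pseudo-convergent sequence of `F` with pseudo-limit `z` of ALGEBRAIC type
would acquire a pseudo-limit `θ ∈ F^h ⊆ F^c` (Kaplansky 1942 Thm. 3 applied to `F^h`), and an element
`c ∈ F` close to `θ` would realise `v (z - c) ≥ sup {v (z - a)}`, contradicting "no maximum" (KK09 Lemma
(nomax)) — so every such sequence is of transcendental type, and interleaving (Kaplansky 1942 Lemma 5:
`v f(a_ν)` is eventually constant or eventually strictly increasing) gives (trat).
[Kaplansky1942 = Duke Math. J. 9 (1942) 303–321, Lemma 5, Thm. 3; Kuhlmann2010 = arXiv:1003.5678 Lemma 2.4,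
Thm. 2.14; Kuhlmann arXiv:1004.2135 Thm. 3 (p. 3); KnafKuhlmann2009 Lemma 2.16 (p. 10)] -/
def TratOfDefectlessBase : Prop :=
  ∀ (K : Type) [Field K] (O : ValuationSubring K), Nonempty O.valuation.RankOne →
    ∀ F : Subfield K, IsDefectlessField F (O.comap (algebraMap F K)) →
    ∀ z : K, (∀ P : Polynomial K, (∀ i, P.coeff i ∈ F) → P.eval z = 0 → P = 0) →
      (∀ w ∈ Subfield.closure ((F : Set K) ∪ {z}), w ≠ 0 → ∃ b ∈ F, O.valuation w = O.valuation b) →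
      (∀ w ∈ Subfield.closure ((F : Set K) ∪ {z}), w ∈ O → ∃ c ∈ F, O.valuation (w - c) < 1) →
      (∃ b : K, b ≠ 0 ∧ ∀ a ∈ F, O.valuation b ≤ O.valuation (z - a)) →
      ∀ g : Polynomial K, (∀ i, g.coeff i ∈ F) →
        ∃ a₀ ∈ F, ∃ α : O.ValueGroup, ∀ a ∈ F,
          O.valuation (z - a) ≤ O.valuation (z - a₀) → O.valuation (g.eval a) = α

variable (k) in
/-- The DEFECTLESS-BOUNDED-TOP DATUM with base bound `c` (the defect-depth-zero locus of the residual, typed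
with the tree predicate `IsDefectlessField`): `K = F₁(z)(η)` with `F₁` finitely generated of
`tr.deg_k ≤ c` and DEFECTLESS for `O ∩ F₁`, `z` transcendental over `F₁` with `F₁(z) | F₁` immediate and
`z` at bounded distance from `F₁` (NOT in the completion — disjoint from the gen-15 dense datum), and `η ∈ O`
a Hensel root over `O ∩ F₁(z)` generating `K`.  The Kaplansky clause of `KHTopBelow` is REPLACED by
defectlessness + boundedness; the bridge `TratOfDefectlessBase` restores it. -/
def DefectlessTopBelow (O : ValuationSubring K) (c : ℕ) : Prop :=
  ∃ (F₁ : IntermediateField k K) (z η : K), F₁.FG ∧ Algebra.trdeg k F₁ ≤ c ∧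
    IsDefectlessField F₁.toSubfield (O.comap (algebraMap F₁.toSubfield K)) ∧
    (∀ P : Polynomial K, (∀ i, P.coeff i ∈ F₁.toSubfield) → P.eval z = 0 → P = 0) ∧
    (∀ w ∈ Subfield.closure ((F₁.toSubfield : Set K) ∪ {z}), w ≠ 0 →
      ∃ b ∈ F₁.toSubfield, O.valuation w = O.valuation b) ∧
    (∀ w ∈ Subfield.closure ((F₁.toSubfield : Set K) ∪ {z}), w ∈ O →
      ∃ c ∈ F₁.toSubfield, O.valuation (w - c) < 1) ∧
    (∃ b : K, b ≠ 0 ∧ ∀ a ∈ F₁.toSubfield, O.valuation b ≤ O.valuation (z - a)) ∧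
    η ∈ O ∧
    Subfield.closure (((Subfield.closure ((F₁.toSubfield : Set K) ∪ {z}) : Subfield K) : Set K) ∪ {η})
      = ⊤ ∧
    ∃ f : Polynomial K, f.Monic ∧
      (∀ i, f.coeff i ∈ O ∧ f.coeff i ∈ Subfield.closure ((F₁.toSubfield : Set K) ∪ {z})) ∧
      f.eval η = 0 ∧ O.valuation ((Polynomial.derivative f).eval η) = 1

/-- **K16 · modulo the printed bridge, a defectless bounded top is a Kaplansky–Hensel top** (kernel). [folklore] -/
theorem khTopBelow_of_defectlessTop (hT : TratOfDefectlessBase) (O : ValuationSubring K)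
    (h1 : Nonempty O.valuation.RankOne) {c : ℕ} (hD : DefectlessTopBelow k O c) : KHTopBelow k O c := by
  obtain ⟨F₁, z, η, hfg, htr, hdef, htrans, hval, hres, hbd, hηO, hgen, f, hf⟩ := hD
  exact ⟨F₁, z, η, hfg, htr, htrans, hval, hres,
    hT K O h1 F₁.toSubfield hdef z htrans hval hres hbd, hηO, hgen, f, hf⟩

end Defectless

/-- CELL (DECIDED for `c ≤ 3` modulo the floor and the printed bridge: `defectlessHenselLU_three`):
rank-one valuation rings of function fields of transcendence degree `≤ n` carrying a defectless bounded
top over a finitely generated subfield of transcendence degree `≤ c`. -/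
def DefectlessHenselLU (c n : ℕ) : Prop :=
  ∀ p : ℕ, p.Prime → ∀ (k K : Type) [Field k] [CharP k p] [Field K] [Algebra k K],
    Algebra.trdeg k K ≤ n → ∀ O : ValuationSubring K, Nonempty O.valuation.RankOne →
    DefectlessTopBelow k O c → RelLocalUniformization k K O

/-- The Kaplansky–Hensel cell contains the defectless-bounded-top cell, modulo the bridge (kernel). [folklore] -/
theorem defectlessHenselLU_of_kh (hT : TratOfDefectlessBase) {c n : ℕ} (h : KaplanskyHenselLU c n) :
    DefectlessHenselLU c n := by
  intro p hp k K _ _ _ _ hn O h1 hD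
  exact h p hp k K hn O (khTopBelow_of_defectlessTop hT O h1 hD)

/-- **DECIDED-MOD-FLOOR-AND-BRIDGE**: at every rung `n`, every rank-one valuation of a function field of
transcendence degree `≤ n` in characteristic `p` that is a defectless bounded top over a finitely generated
subfield of transcendence degree `≤ 3` admits relative local uniformization — modulo Cossart–Piltant 2019 and
the printed bridge `TratOfDefectlessBase` (Kaplansky 1942 + Kuhlmann 2010, the latter PROVED in the tree). [folklore] -/
theorem defectlessHenselLU_three (hCP : CossartPiltant2019LU3.{0}) (hT : TratOfDefectlessBase) (n : ℕ) :
    DefectlessHenselLU 3 n :=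
  defectlessHenselLU_of_kh hT (khLU_three hCP n)

/-- WEAKER-than-rung-`n` (no bridge needed). [folklore] -/
theorem defectlessHenselLU_of_luRel' {c n : ℕ} (h : LURel n) : DefectlessHenselLU c n :=
  fun p hp k K _ _ _ _ hn O _ _ => h p hp k K hn O

/-- WEAKER-than-the-root (no bridge needed). [folklore] -/
theorem defectlessHenselLU_of_root (hS : _root_.ResolutionOfSingularities) (c n : ℕ) :
    DefectlessHenselLU c n :=
  defectlessHenselLU_of_luRel' (luRel_of_root hS n)

end Summit.ResolutionOfSingularities.ResolutionOfSingularities.Theorems.KaplanskyLadder
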